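import Mathlib
import Summits.Langlands.Langlands.Theses.PhantomRMYoshida
import Summits.Langlands.Langlands.Theorems.PhantomRMYoshidaStableYoshidaCongruenceSector
import Summits.Langlands.Langlands.Theorems.PhantomRMYoshidaStableYoshidaCongruenceLocalConditionsTransfer
import Summits.Langlands.Langlands.Theorems.PhantomRMYoshidaStableYoshidaCongruenceResidualLattice
import Summits.Langlands.Langlands.Theorems.PhantomRMYoshidaStableYoshidaCongruenceModelFp
import Summits.Langlands.Langlands.Theorems.PhantomRMYoshidaStableYoshidaCongruenceSymplecticFormFp
import Summits.Langlands.Langlands.Theorems.PhantomRMYoshidaStableYoshidaCongruenceOrdinaryFrameFp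
import Literature.NumberTheory.GaloisRepresentations.SerreWeight
import Literature.AlgebraicGeometry.Motives.FaltingsAbelian
import Literature.AlgebraicGeometry.Motives.FaltingsFinitenessI
import Literature.AlgebraicGeometry.Motives.FaltingsAbelianOfFinitenessIProofs
import HarnessLib

/-!
# Route `PhantomRMYoshida`, crux `StableYoshidaCongruence` (stmt-Langlands-13640), line
# `burkhardt-weddle-two-three-anchor`: the SECTOR THEOREM — the crux on the Burkhardt–Weddle sector,
# modulo four published facts

`stub_bwSectorModuloFacts` (registered stub of the lead-c1 skeleton): granted the four published facts — Faltings
(through the route's named-fact gate `FaltingsFinitenessI`, stmt-Langlands-15084: Finiteness I over `ℚ`, whence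
Satz 3–4 in the tree), the Serre–Tate ordinary filtration, the Boxer–Calegari–Gee–Pilloni `2`–`3` switch onto a
modular abelian surface, the Weil pairing — the crux `StableYoshidaCongruence` holds at every datum
`(p, k, red, σ, σ')` of the BURKHARDT–WEDDLE SECTOR: `p = 3`, `charpoly σ · charpoly σ'` is `𝔽₃`-rational,
`σ, σ'` are peu ramifiées at `3`, and unramified at `2` with product of Frobenius polynomials `≠ (X² ± X + 2)²`.
Unlike the sibling line's sector (`Switchable 3 k σ σ'`, which POSITS a symplectic ordinary-flat `GSp₄(𝔽₃)`-model),
here the model (`stub_modelFp`, Deligne–Serre descent), its symplectic form (`stub_symplecticFormFp`) and its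
ordinary `𝔽₃`-frame (`stub_residualLattice` + `stub_ordinaryFrameFp`, from the crux's own `Sh`-witness H5) are
DERIVED from the crux's hypotheses; the local side conditions pass to the model by `stub_localConditionsTransfer`;
then the sibling line's landed sector theorem `stub_sectorModuloFacts` (p94938) concludes.  The sector predicate is
inlined (no new definition).  Lead prover-line-stmt-Langlands-13640-c1-0, 2026-08-16.
-/

set_option linter.dupNamespace false

noncomputable section

open CategoryTheory IsDedekindDomain Polynomial
open scoped NumberField
open Literature.NumberTheory.GaloisRepresentations Literature.NumberTheory.Automorphic
open Literature.AlgebraicGeometry.Motives (AbelianVariety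
  faltings_tate_bijective_of_forall_finite_isoClasses_isogenous
  isSemisimpleRepresentation_rationalTateRep_of_finite_isoClasses_isogenous)
open Literature.AlgebraicGeometry.Motives.AbelianVariety (finite_isoClasses_isogenous)
open Literature.NumberTheory.DiophantineGeometry (weilPairing_rationalTateModule
  ordinaryReduction_tateModule_filtration bcgp_switch_exists_modular_abelianSurface)
open Summit.Langlands.Langlands.Theses.PhantomRMYoshida
open Summit.Langlands.Langlands.Cruxes.StableYoshidaCongruence.LevelThreeWeierstrassSwitch

namespace Summit.Langlands.Langlands.Cruxes.StableYoshidaCongruence.BurkhardtWeddleTwoThreeAnchor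

/-- **The Burkhardt–Weddle sector delivers the sibling line's `Switchable`** (sorry-free from the landed
Stubs 1–5): given the crux's hypotheses H2–H5 at data in the sector, `σ ⊕ σ'` has a symplectic-`ε̄⁻¹`,
ordinary-flat, switchable-at-`2` `GSp₄(𝔽_p)`-model. [cite: BoxerCalegariGeePilloni2025, Lemma 9.4.2 and
Cor. 9.3.5 (arXiv:2502.20645); DeligneSerreASENS1974, Lemme 6.13] -/
theorem switchable_of_bwSector (p : ℕ) [Fact p.Prime] (hp : p ≠ 2) (k : Type) [Field k] [CharP k p]
    [IsAlgClosed k] [TopologicalSpace k] [DiscreteTopology k] (red : Valued.integer (PadicAlgCl p) →+* k)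
    (σ σ' : FramedGaloisRep ℚ k 2)
    (hrat : ∀ g : Field.absoluteGaloisGroup ℚ, ∃ Q : Polynomial (ZMod p),
      Q.map (ZMod.castHom (dvd_refl p) k) = FramedRep.charpoly σ g * FramedRep.charpoly σ' g)
    (hpeu : ∀ v : HeightOneSpectrum (𝓞 ℚ), ((p : ℕ) : 𝓞 ℚ) ∈ v.asIdeal →
      ModPGaloisRep.IsPeuRamifie (σ.toLocal v) ∧ ModPGaloisRep.IsPeuRamifie (σ'.toLocal v))
    (htwo : ∀ v : HeightOneSpectrum (𝓞 ℚ), ((2 : ℕ) : 𝓞 ℚ) ∈ v.asIdeal →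
      σ.IsUnramifiedAt v ∧ σ'.IsUnramifiedAt v ∧
      ∃ P₁ P₂ : Polynomial k, σ.HasFrobCharpolyAt v P₁ ∧ σ'.HasFrobCharpolyAt v P₂ ∧
        P₁ * P₂ ≠ (X ^ 2 + X + C 2) ^ 2 ∧ P₁ * P₂ ≠ (X ^ 2 - X + C 2) ^ 2)
    (hirr : σ.toGaloisRep.IsIrreducible) (hirr' : σ'.toGaloisRep.IsIrreducible) (hdet : DetCond p σ σ')
    (hnc : NonConj σ σ') (hw : ∃ ρ : FramedGaloisRep ℚ (PadicAlgCl p) 4, Sh red σ σ' ρ) :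
    Switchable p k σ σ' := by
  obtain ⟨ρw, -, hloc, hpair⟩ := hw
  obtain ⟨ρb, hmodel⟩ := stub_modelFp p k σ σ' hirr hirr' hrat
  have hsymp := stub_symplecticFormFp p hp k σ σ' ρb hirr hirr' hdet hnc hmodel
  obtain ⟨hpeuT, htwoT⟩ := stub_localConditionsTransfer p k σ σ' ρb hmodel
  refine ⟨ρb, hsymp, hmodel, fun v hv => ⟨?_, ?_⟩, fun v hv => ?_⟩
  · exact hpeuT v (hpeu v hv).1 (hpeu v hv).2
  · obtain ⟨M, hM1, hM2, hM3, -⟩ :=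
      stub_residualLattice p hp k red σ σ' ρw v hv (hloc v hv).1 (hloc v hv).2 hpair
    exact stub_ordinaryFrameFp p hp k σ σ' ρb M v hv hirr hirr' hdet hmodel hM1 hM2 hM3
  · obtain ⟨hσ, hσ', hP⟩ := htwo v hv
    exact htwoT v hσ hσ' hP

/-- **The crux on the Burkhardt–Weddle sector, modulo four published facts** (registered stub
`stub_bwSectorModuloFacts`; the sector predicate `BWSector` of the skeleton is INLINED).  Facts: Faltings through
`FaltingsFinitenessI` (stmt-Langlands-15084; Satz 3/4 by `FaltingsAbelianOfFinitenessIProofs`), Serre–Tate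
`ordinaryReduction_tateModule_filtration`, BCGP `bcgp_switch_exists_modular_abelianSurface`, Weil
`weilPairing_rationalTateModule`.  Proof: `switchable_of_bwSector` + the sibling line's landed sector theorem
`stub_sectorModuloFacts` (p94938).
[cite: BoxerCalegariGeePilloni2025, Lemma 9.4.2, Thm. 8.3.2, Thm. 9.5.2 (arXiv:2502.20645); Faltings1983Endlichkeit,
§5 Satz 3–4, §6 Satz 5–6] -/
theorem stub_bwSectorModuloFacts :
    FaltingsFinitenessI → ordinaryReduction_tateModule_filtration →
    bcgp_switch_exists_modular_abelianSurface → weilPairing_rationalTateModule →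
    ∀ (p : ℕ) [Fact p.Prime], p ≠ 2 → ∀ (k : Type) [Field k] [CharP k p] [IsAlgClosed k]
      [TopologicalSpace k] [DiscreteTopology k] (red : Valued.integer (PadicAlgCl p) →+* k)
      (σ σ' : FramedGaloisRep ℚ k 2),
      (p = 3 ∧
        (∀ g : Field.absoluteGaloisGroup ℚ, ∃ Q : Polynomial (ZMod p),
          Q.map (ZMod.castHom (dvd_refl p) k) = FramedRep.charpoly σ g * FramedRep.charpoly σ' g) ∧
        (∀ v : HeightOneSpectrum (𝓞 ℚ), ((p : ℕ) : 𝓞 ℚ) ∈ v.asIdeal →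
          ModPGaloisRep.IsPeuRamifie (σ.toLocal v) ∧ ModPGaloisRep.IsPeuRamifie (σ'.toLocal v)) ∧
        (∀ v : HeightOneSpectrum (𝓞 ℚ), ((2 : ℕ) : 𝓞 ℚ) ∈ v.asIdeal →
          σ.IsUnramifiedAt v ∧ σ'.IsUnramifiedAt v ∧
          ∃ P₁ P₂ : Polynomial k, σ.HasFrobCharpolyAt v P₁ ∧ σ'.HasFrobCharpolyAt v P₂ ∧
            P₁ * P₂ ≠ (X ^ 2 + X + C 2) ^ 2 ∧ P₁ * P₂ ≠ (X ^ 2 - X + C 2) ^ 2)) →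
      CruxAt p k red σ σ' := by
  intro hFI hST hBCGP hWeil p _ hp k _ _ _ _ _ red σ σ' hsec hA hA' hirr hirr' hdet hnc hw
  obtain ⟨hp3, hrat, hpeu, htwo⟩ := hsec
  have hfin : ∀ A : AbelianVariety ℚ, finite_isoClasses_isogenous A := fun A _ => hFI A
  exact stub_sectorModuloFacts
    (fun q _ B => faltings_tate_bijective_of_forall_finite_isoClasses_isogenous q hfin B B)
    (fun q _ B => isSemisimpleRepresentation_rationalTateRep_of_finite_isoClasses_isogenous B q (hfin B))
    hST hBCGP hWeil p hp k red σ σ' hp3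
    (switchable_of_bwSector p hp k red σ σ' hrat hpeu htwo hirr hirr' hdet hnc hw) hA hA' hirr hirr' hdet hnc hw

end Summit.Langlands.Langlands.Cruxes.StableYoshidaCongruence.BurkhardtWeddleTwoThreeAnchor

end
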